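import Summits.HodgeConjecture.HodgeConjecture.Theorems.F0P3SpectralPacketFactorisationPkOn              -- ★ (N) FILE 3x′: the unsigned (P1) theorem and its whole import cone (★ 3u″, 3u‴, 3y′, 3w, `ghOfFibres`, ★ v8 `FactorisationPk`)
import Summits.HodgeConjecture.HodgeConjecture.Theorems.F0P3SpectralPacketPresentationBridgeOnSigned   -- ★ 3u″-S (same seat): `trH_partner_eq_trHSψ_mul_prod_of_eval_eq_off_signed`, `trH_partner_eq_zero_of_not_ramFinsetH_subset_of_eval_eq_signed`
import Summits.HodgeConjecture.HodgeConjecture.Theorems.F0P3bLocalExpansionAtKitOfRecord                  -- ★ `HTraceProductForm` (the (P3′)-H clause the junction re-scales)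
import HarnessLib

/-!
# (N) DEFS, FILE 3x′-S — CLAUSE (P1) `FactorisationPk` AT THE TUPLE WITH THE SIGNED `H`-SIDE LAW (KT2″) AND THE σ-SCALED `H`-TRACE SLOT; the (P3′)-H clause at `σ·c`
# (Rogawski §14.6 pp. 242–244 «`Δ′_v = c_v Δ″_v`, `c = ∏ c_v`»; §13.7 p. 206; (14.2.1) pp. 232–233; §14.3; p. 243 l. 9–17; §4.3 p. 44)

Cell `hodgecm-mathlib` (D-0151), F0∕P3c line LH7 (closer stub `stub_PKtuple`, row #181), crux H413 (`stmt-HodgeConjecture-24833`); seat LH7-p02 (g0) on LEAD F0P3a-plan (g13)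
T12-13 «K2″» (repair (R-b) of FLAG F10; desk F0P3-plan (g13) PRE-PRICE §6 (ii)).  PROOF LANE: two theorems, 0 definitions, no instance, no notation, no named fact, no `sorry`;
`--supports stmt-HodgeConjecture-24833 --as helper`; never imports a `Cruxes/…/Lines` module.  ★ 3x′ is NOT edited (supersede-not-edit).
HONEST LABEL: HC_CM is proved only modulo the 7 printed citations (2 remaining: hLiu418 = stmt-HodgeConjecture-24832, h413 = stmt-HodgeConjecture-24833) until rung 0 closes;
this file proves no printed statement.

THE SIGNED-KIT-OF-RECORD CURRENCY of this file (PROOF lane: hypotheses in their unfolded ★ shapes, exactly as ★ 3x′ takes `htens`∕`htensH`):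
* `s : Places L → ℤ` with `hs : ∀ v ∉ Sbad, s v = 1` — the place-wise sign of (KT2″); `σ := ∏_{v ∈ Sbad} s_v` is the FRAME CONSTANT by which EVERY `Tr ρ(f′^H)` is scaled
  (★ 3u″-S: all places contribute, in or out of `S`);
* `hlawψ` — (KT2″) for every spectral `H`-packet: `Tr ρ_v(f^H) = s_v · Σ_{π ∈ ξ_H(ρ_v)} ⟨ρ_v, π⟩ Tr π(f′ ∘ ψ_v⁻¹)` on `Δ′_v`-matched TEST pairs (= ★ `SpectralPacketH.CharIdentityψS … s`, same seat, def lane);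
* the socket's `trHS` slot is `fun S ρ f′_S => σ · ρ.trHSψ ψ S (ψ_* νG) archTr f′_S` in `htens`, `htensH` AND the conclusion — so (P1)-H «`Tr ρ(f′^H) = trHS S ρ f′_S · f^{S∧}(t(ρ))`» is
  LITERALLY ★ v8 `FactorisationPk` at the kit of record built on that slot.
§2 `hTraceProductForm_ghOfFibres_const_mul`: the (P3′)-H clause ★ `HTraceProductForm … c …` for a `ghOfFibres` side with slot `trHS` gives the clause at `σ·c` for the side with slot `σ·trHS`
(the junction's `hPH` at K9's re-based outer sign `c′ := σ·c`; `MatchesS`, `TestSH` do not read the slot).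

References: [Rogawski1990] §14.6 pp. 242–244, p. 243 l. 9–17; §13.2 pp. 199–200; §13.7 p. 206; §14.2 (14.2.1) pp. 232–233; §14.3 p. 233; §14.4 Prop. 14.4.1 (c), 14.4.2 pp. 235–236;
§4.3 p. 44; §5.4 p. 72.  [FlathCorvallis1979] Thm. 3.  [CartierCorvallis1979] §IV.1 Cor. 4.1.
-/


set_option autoImplicit false
-- the mandated namespace repeats `HodgeConjecture.HodgeConjecture`, as in every `Theorems/*.lean` of this sub-problem
set_option linter.dupNamespace false

noncomputable section

open NumberField IsDedekindDomain MeasureTheory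
open scoped Matrix MatrixGroups

open Literature.NumberTheory Literature.NumberTheory.Automorphic Literature.NumberTheory.Automorphic.UnitaryGroup
open Literature.NumberTheory.Rogawski1990 Literature.NumberTheory.GaloisRepresentations
open Literature.RepresentationTheory.BorelWallach2000 Literature.RepresentationTheory.KonnoKonno2007
open Summit.HodgeConjecture.HodgeConjecture.Cruxes.H413.F0P3InnerFormClassificationV6
open Summit.HodgeConjecture.HodgeConjecture.Cruxes.H413.F0P3LocalPacketKit
open Summit.HodgeConjecture.HodgeConjecture.Cruxes.H413.F0P3ArchPacketKit
open Summit.HodgeConjecture.HodgeConjecture.Cruxes.H413.F0P3SemilocalTestFunctionsOfRecord (TestS₀ tens₀ toPureTensor coe_tens₀)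
open Summit.HodgeConjecture.HodgeConjecture.Cruxes.H413.F0P3TestFunctionsOfRecord (Unr₀ hat₀)
open Summit.HodgeConjecture.HodgeConjecture.Cruxes.H413.F0P3UnrTensorInstance (UnrTensor)
open Summit.HodgeConjecture.HodgeConjecture.Cruxes.H413.F0P3KitOfRecord (GHSide XiSide kitOfRecord)
open Summit.HodgeConjecture.HodgeConjecture.Cruxes.H413.F0P3GHSideOfFibres (ghOfFibres matches_tensG_tensH)

namespace Summit.HodgeConjecture.HodgeConjecture.Cruxes.H413.F0P3SpectralPacket.SpectralPacketG

open Summit.HodgeConjecture.HodgeConjecture.Cruxes.H413.F0P3GlobalPacket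
open Summit.HodgeConjecture.HodgeConjecture.Cruxes.H413.F0P3ArchPacketKit.ArchPacketKitH

variable {L : Type} [Field L] [NumberField L] [IsCMField L] {H : Matrix (Fin 3) (Fin 3) L}
  -- the frame, T1's sockets other than the packet types, and `kitOfRecord`'s remaining parameters
  (ι : L →+* ℂ) (T : GL (Fin 3) ℂ)
  (hT : (T : Matrix (Fin 3) (Fin 3) ℂ)ᴴ * H.map ι * (T : Matrix (Fin 3) (Fin 3) ℂ) = Literature.Geometry.ComplexHyperbolic.BallModel.J)
  (μGp : Measure (Gp L H).automorphicQuotient) [(Gp L H).IsAutomorphicMeasure μGp]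
  (traceGp : TestGp L H →ₗ[ℂ] ℂ) (Smooth : TestGp L H → Prop) (Matches : TestGp L H → TestG L → TestH L → Prop)
  (μω : HeckeCharacter L) (c : ℚ) (jInf dsInf : ℤ → ℤ → ℤ → Cinf)
  (archTr : Cinf → (UnitaryGroup.arch (↥(maximalRealSubfield L)) L (IsCMField.complexConj L) 3 H → ℂ) → ℂ)
  -- the adelic Haar measure in the LETTER's typing (`borel`-based, instances re-introduced by `letI` as in `K9SpectralLetterSigned` — so the conclusion matches the letter's clause up to `rfl`)
  (νA : @Measure (Gp L H).Adelic (borel _)) (hνA : letI : MeasurableSpace (Gp L H).Adelic := borel _; IsFiniteMeasureOnCompacts νA)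
  (νG : ∀ v : Places L, @Measure ((cmDatum L 3 H).Local v) (borel _))
  (ramCls₀ : DiscreteAutomorphicRep (Gp L H) μGp → Set (Places L))
  -- the (N) kits and slots
  {𝔩 : ∀ v : HeightOneSpectrum (𝓞 ↥(maximalRealSubfield L)), LocalPacketKit L (splitForm L 3) v} {𝔞 : ArchPacketKit} {𝔞H : ArchPacketKitH 𝔞}
  {DiscH : GlobalPacketH 𝔩 → 𝔞H.PktInfH → Prop}
  {μ : Measure (adelicGroupData (↥(maximalRealSubfield L)) L (IsCMField.complexConj L) 3 (splitForm L 3)).automorphicQuotient}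
  [SMulInvariantMeasure (adelicGroupData (↥(maximalRealSubfield L)) L (IsCMField.complexConj L) 3 (splitForm L 3)).Adelic
    (adelicGroupData (↥(maximalRealSubfield L)) L (IsCMField.complexConj L) 3 (splitForm L 3)).automorphicQuotient μ]
  [∀ v : HeightOneSpectrum (𝓞 ↥(maximalRealSubfield L)), MeasurableSpace ((cmDatum L 3 (splitForm L 3)).Local v)]
  [∀ v : HeightOneSpectrum (𝓞 ↥(maximalRealSubfield L)), BorelSpace ((cmDatum L 3 (splitForm L 3)).Local v)]
  [∀ v : HeightOneSpectrum (𝓞 ↥(maximalRealSubfield L)), MeasurableSpace ((cmDatum L 2 (splitForm L 2)).Local v × (cmDatum L 1 (splitForm L 1)).Local v)]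
  [∀ v : HeightOneSpectrum (𝓞 ↥(maximalRealSubfield L)), BorelSpace ((cmDatum L 2 (splitForm L 2)).Local v × (cmDatum L 1 (splitForm L 1)).Local v)]
  (infOf : GlobalPacket 𝔩 → 𝔞.PktInf) (aTok : ∀ v : HeightOneSpectrum (𝓞 ↥(maximalRealSubfield L)), Set (𝔩 v).Pkt)
  (nG : HomogPacketG 𝔩 𝔞 μ infOf aTok → ℂ) (nH : SpectralPacketH 𝔩 𝔞 𝔞H DiscH → ℂ)
  (ξd : XiSide L H (HomogPacketG 𝔩 𝔞 μ infOf aTok) (SpectralPacketH 𝔩 𝔞 𝔞H DiscH))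
  (νH : ∀ v : HeightOneSpectrum (𝓞 ↥(maximalRealSubfield L)), Measure ((cmDatum L 2 (splitForm L 2)).Local v × (cmDatum L 1 (splitForm L 1)).Local v))
  [∀ v, (νH v).IsMulLeftInvariant] [∀ v, IsFiniteMeasureOnCompacts (νH v)]
  (archTrG : Cinf → (UnitaryGroup.arch (↥(maximalRealSubfield L)) L (IsCMField.complexConj L) 3 (splitForm L 3) → ℂ) → ℂ)
  (archTrH : 𝔞H.CinfH → (UnitaryGroup.arch (↥(maximalRealSubfield L)) L (IsCMField.complexConj L) 2 (splitForm L 2) × UnitaryGroup.arch (↥(maximalRealSubfield L)) L (IsCMField.complexConj L) 1 (splitForm L 1) → ℂ) → ℂ)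


/-- **(P1) `FactorisationPk` OF LETTER K9-STF AT THE HOMOGENEOUS COHERENT TUPLE, SIGNED H-SIDE (K2″)** (= ★ 3x′ `factorisationPk_kitOfRecord_homOn` with the finite-place law (o1)
`CharIdentityψ` replaced by the SIGNED law (KT2″) ★ `SpectralPacketH.CharIdentityψS … s` (unfolded) for a place-wise sign `s` with finite support `Sbad`, and the socket's `H`-side
`S`-trace slot SCALED BY THE FRAME CONSTANT `σ : ℚ` with `(σ : ℂ) = ∏_{v ∈ Sbad} s_v` (`hσ`; `trHS := fun S ρ f′_S => σ · ρ.trHSψ …`): every finite place contributes its sign to `Tr ρ(f′^H)` (★ 3u″-S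
`trH_partner_eq_trHSψ_mul_prod_of_eval_eq_off_signed`), so «`Tr ρ(f′^H) = trHS S ρ f′_S · f^{S∧}(t(ρ))`» holds at the scaled slot and `0` on the ramified branch (★ 3u″-S zero twin); the two
`G`-branches are VERBATIM.  Print: the inner form's fixed local transfer factors differ from the transported ones by signs `c_v`, `c = ∏ c_v`, carried outside the canonical pairing
[Rogawski1990 §14.6 pp. 242–244]; LEAD F0P3a-plan (g13) T12-13 «K2″» (repair (R-b) of FLAG F10); census `F0/P3c/LH7/LH7-p02/g0/CENSUS-TB-KG1-sign-consumption.v1.md` §D.  The T-B junction ED. 3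
instantiates `s := formSignAt L H` (LH7-p01 Δ1) with `Sbad` from ★ `exists_finset_forall_formSignAt_eq_one`, and absorbs `σ` into K9's outer sign `c′ := σ·c`.
[cite: FlathCorvallis1979, Thm. 3] [cite: CartierCorvallis1979, §IV.1 Cor. 4.1] [cite: Rogawski1990, §13.7 p. 206; §14.2 (14.2.1) pp. 232–233; §14.3 p. 233; §14.6 pp. 242–244, p. 243 l. 9–17; §4.3 p. 44] -/
theorem factorisationPk_kitOfRecord_homOn_signed
    (ψ : ∀ v : HeightOneSpectrum (𝓞 ↥(maximalRealSubfield L)), (cmDatum L 3 H).Local v ≃ₜ* (cmDatum L 3 (splitForm L 3)).Local v)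
    (hνl : ∀ v : HeightOneSpectrum (𝓞 ↥(maximalRealSubfield L)), letI : ∀ v : HeightOneSpectrum (𝓞 ↥(maximalRealSubfield L)), MeasurableSpace ((cmDatum L 3 H).Local v) := fun _ => borel _; (νG v).IsMulLeftInvariant)
    (hνc : ∀ v : HeightOneSpectrum (𝓞 ↥(maximalRealSubfield L)), letI : ∀ v : HeightOneSpectrum (𝓞 ↥(maximalRealSubfield L)), MeasurableSpace ((cmDatum L 3 H).Local v) := fun _ => borel _; IsFiniteMeasureOnCompacts (νG v))
    -- kit laws ((TF-1)∕S₀ and (TF-ind)∕S₀ are derived below, not assumed)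
    (h4 : ∀ v : HeightOneSpectrum (𝓞 ↥(maximalRealSubfield L)), (𝔩 v).UnramLaw)
    (hU : ∀ v : HeightOneSpectrum (𝓞 ↥(maximalRealSubfield L)), UnrDefLaw (𝔩 v))
    (hadm : ∀ (v : HeightOneSpectrum (𝓞 ↥(maximalRealSubfield L))) (P : (𝔩 v).Pkt), ∀ π ∈ (𝔩 v).mem P, π.IsAdmissible)
    (hadmH : ∀ (v : HeightOneSpectrum (𝓞 ↥(maximalRealSubfield L))) (ρ : (𝔩 v).PktH), ∀ σ ∈ (𝔩 v).memH ρ, σ.IsAdmissible)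
    (h1H : ∀ ρ : SpectralPacketH 𝔩 𝔞 𝔞H DiscH, ρ.UnramTraceOneH νH)
    (S₀ : Finset (HeightOneSpectrum (𝓞 ↥(maximalRealSubfield L))))
    (hgood : ∀ v ∉ S₀, ∀ r : SmoothIrrep ((UnitaryGroup.cmDatum L 3 (splitForm L 3)).Local v), r.ρ.IsAdmissible →
      Module.finrank ℂ (r.ρ.fixedPoints (cmLocalIntegralLevel L 3 (splitForm L 3) v)) ≤ 1)
    (hψK : ∀ v ∉ S₀, (cmLocalIntegralLevel L 3 H v).map (ψ v : (cmDatum L 3 H).Local v →* (cmDatum L 3 (splitForm L 3)).Local v) =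
      cmLocalIntegralLevel L 3 (splitForm L 3) v)
    (hvol : ∀ v : HeightOneSpectrum (𝓞 ↥(maximalRealSubfield L)), (νG v).real (cmLocalIntegralLevel L 3 H v : Set ((cmDatum L 3 H).Local v)) = 1)
    -- homogeneity of the archimedean characters (`archTrG` on `G_∞` NEW: feeds ★ 3y `presentationIndepOn_of_admissible`)
    (harchG : ∀ (a : Cinf) (k : ℂ) (f : UnitaryGroup.arch (↥(maximalRealSubfield L)) L (IsCMField.complexConj L) 3 (splitForm L 3) → ℂ), archTrG a (k • f) = k * archTrG a f)
    (harch' : ∀ (a : Cinf) (k : ℂ) (f : UnitaryGroup.arch (↥(maximalRealSubfield L)) L (IsCMField.complexConj L) 3 H → ℂ), archTr a (k • f) = k * archTr a f)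
    (harchH : ∀ (a : 𝔞H.CinfH) (k : ℂ) (f : UnitaryGroup.arch (↥(maximalRealSubfield L)) L (IsCMField.complexConj L) 2 (splitForm L 2) × UnitaryGroup.arch (↥(maximalRealSubfield L)) L (IsCMField.complexConj L) 1 (splitForm L 1) → ℂ), archTrH a (k • f) = k * archTrH a f)
    -- the GUARDED transfer laws (m3) (o1) (o6) at the pin's orbital families
    (m' : letI : ∀ γ : UnitaryGroup.arch (↥(maximalRealSubfield L)) L (IsCMField.complexConj L) 3 H,
        MeasurableSpace (UnitaryGroup.arch (↥(maximalRealSubfield L)) L (IsCMField.complexConj L) 3 H ⧸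
          Subgroup.centralizer ({γ} : Set (UnitaryGroup.arch (↥(maximalRealSubfield L)) L (IsCMField.complexConj L) 3 H))) := fun _ => borel _;
      OrbitalMeasureFamily (UnitaryGroup.arch (↥(maximalRealSubfield L)) L (IsCMField.complexConj L) 3 H))
    (m : letI : ∀ γ : UnitaryGroup.arch (↥(maximalRealSubfield L)) L (IsCMField.complexConj L) 3 (splitForm L 3),
        MeasurableSpace (UnitaryGroup.arch (↥(maximalRealSubfield L)) L (IsCMField.complexConj L) 3 (splitForm L 3) ⧸
          Subgroup.centralizer ({γ} : Set (UnitaryGroup.arch (↥(maximalRealSubfield L)) L (IsCMField.complexConj L) 3 (splitForm L 3)))) := fun _ => borel _;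
      OrbitalMeasureFamily (UnitaryGroup.arch (↥(maximalRealSubfield L)) L (IsCMField.complexConj L) 3 (splitForm L 3)))
    (hlaw : 𝔞.InnerTransferLawTest L H m' m archTrG archTr)
    {Δ' : ∀ v : HeightOneSpectrum (𝓞 ↥(maximalRealSubfield L)), LocalTransferFactor L H v}
    (mH : letI : ∀ (v : HeightOneSpectrum (𝓞 ↥(maximalRealSubfield L))) (a : (cmDatum L 2 (splitForm L 2)).Local v × (cmDatum L 1 (splitForm L 1)).Local v), MeasurableSpace (((cmDatum L 2 (splitForm L 2)).Local v × (cmDatum L 1 (splitForm L 1)).Local v) ⧸ Subgroup.centralizer ({a} : Set ((cmDatum L 2 (splitForm L 2)).Local v × (cmDatum L 1 (splitForm L 1)).Local v))) := fun _ _ => borel _;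
      ∀ v : HeightOneSpectrum (𝓞 ↥(maximalRealSubfield L)), OrbitalMeasureFamily ((cmDatum L 2 (splitForm L 2)).Local v × (cmDatum L 1 (splitForm L 1)).Local v))
    (mG' : letI : ∀ (v : HeightOneSpectrum (𝓞 ↥(maximalRealSubfield L))) (γ : (cmDatum L 3 H).Local v), MeasurableSpace ((cmDatum L 3 H).Local v ⧸ Subgroup.centralizer ({γ} : Set ((cmDatum L 3 H).Local v))) := fun _ _ => borel _;
      ∀ v : HeightOneSpectrum (𝓞 ↥(maximalRealSubfield L)), OrbitalMeasureFamily ((cmDatum L 3 H).Local v))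
    -- (KT2″) the SIGNED finite-place law (★ `SpectralPacketH.CharIdentityψS … s` unfolded), for a place-wise sign `s` supported in the finite set `Sbad` (LEAD T12-13 «K2″»; print's `c_v`, pp. 242–244)
    (s : HeightOneSpectrum (𝓞 ↥(maximalRealSubfield L)) → ℤ) (Sbad : Finset (HeightOneSpectrum (𝓞 ↥(maximalRealSubfield L)))) (hs : ∀ v ∉ Sbad, s v = 1)
    -- the FRAME CONSTANT `σ = ∏_{v ∈ Sbad} s_v` as a rational number (it multiplies K9's outer sign `c : ℚ`) with its complex reading
    (σ : ℚ) (hσ : (σ : ℂ) = ∏ v ∈ Sbad, (s v : ℂ))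
    (hlawψ : letI : ∀ v : HeightOneSpectrum (𝓞 ↥(maximalRealSubfield L)), MeasurableSpace ((cmDatum L 3 H).Local v) := fun _ => borel _
      letI : ∀ (v : HeightOneSpectrum (𝓞 ↥(maximalRealSubfield L))) (a : (cmDatum L 2 (splitForm L 2)).Local v × (cmDatum L 1 (splitForm L 1)).Local v), MeasurableSpace (((cmDatum L 2 (splitForm L 2)).Local v × (cmDatum L 1 (splitForm L 1)).Local v) ⧸ Subgroup.centralizer ({a} : Set ((cmDatum L 2 (splitForm L 2)).Local v × (cmDatum L 1 (splitForm L 1)).Local v))) := fun _ _ => borel _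
      letI : ∀ (v : HeightOneSpectrum (𝓞 ↥(maximalRealSubfield L))) (γ : (cmDatum L 3 H).Local v), MeasurableSpace ((cmDatum L 3 H).Local v ⧸ Subgroup.centralizer ({γ} : Set ((cmDatum L 3 H).Local v))) := fun _ _ => borel _
      ∀ (ρ : SpectralPacketH 𝔩 𝔞 𝔞H DiscH) (v : HeightOneSpectrum (𝓞 ↥(maximalRealSubfield L)))
        (fH : (cmDatum L 2 (splitForm L 2)).Local v × (cmDatum L 1 (splitForm L 1)).Local v → ℂ) (f' : (cmDatum L 3 H).Local v → ℂ),
        IsLocSmooth fH → IsLocSmooth f' → IsLocalDeltaTransfer L H v (Δ' v) (mH v) (mG' v) fH f' →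
          (𝔩 v).trPktH (νH v) (ρ.fin.loc v) fH = (s v : ℂ) * (𝔩 v).endoTrPkt (@Measure.map _ _ (borel _) _ (ψ v) (νG v)) (ρ.fin.loc v) (f' ∘ (ψ v).symm))
    {Tinf : ArchTransferFactor L H}
    (mHi : letI : ∀ a : UnitaryGroup.arch (↥(maximalRealSubfield L)) L (IsCMField.complexConj L) 2 (splitForm L 2) × UnitaryGroup.arch (↥(maximalRealSubfield L)) L (IsCMField.complexConj L) 1 (splitForm L 1), MeasurableSpace ((UnitaryGroup.arch (↥(maximalRealSubfield L)) L (IsCMField.complexConj L) 2 (splitForm L 2) × UnitaryGroup.arch (↥(maximalRealSubfield L)) L (IsCMField.complexConj L) 1 (splitForm L 1)) ⧸ Subgroup.centralizer ({a} : Set (UnitaryGroup.arch (↥(maximalRealSubfield L)) L (IsCMField.complexConj L) 2 (splitForm L 2) × UnitaryGroup.arch (↥(maximalRealSubfield L)) L (IsCMField.complexConj L) 1 (splitForm L 1)))) := fun _ => borel _;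
      OrbitalMeasureFamily (UnitaryGroup.arch (↥(maximalRealSubfield L)) L (IsCMField.complexConj L) 2 (splitForm L 2) × UnitaryGroup.arch (↥(maximalRealSubfield L)) L (IsCMField.complexConj L) 1 (splitForm L 1)))
    (hlawInf : 𝔞H.EndoTransferLawTest L H Tinf mHi m' archTrH archTr)
    -- the letter's socket-level `hg`∕`hsm`, and the ξ-side read-backs
    (hg : ∀ f' : TestGp L H, Smooth f' → ∃ (f : TestG L) (fH : TestH L), Matches f' f fH)
    (hsm : ∀ (S : Finset (Places L)) (fS : TestS₀ L H ι T hT S) (fT : Unr₀ L H S), Smooth (tens₀ S fS fT))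
    (hξG : ∀ Q, ξd.evpG Q = Q.1.evpGψ ψ (fun v => @Measure.map _ _ (borel _) _ (ψ v) (νG v))) (hξH : ∀ ρ, ξd.evpH ρ = ρ.evpHψ ψ (fun v => @Measure.map _ _ (borel _) _ (ψ v) (νG v)))
    (hξrG : ∀ Q, ξd.ramG Q = Q.1.fin.ramFinset) (hξrH : ∀ ρ, ξd.ramH ρ = ρ.ramFinsetH)
    -- the pins' tensor witnesses at the record tensors (pin (ix′) `transfer_tensors`, pin (xi″-c) `deltaTransfer`, read through ★ `matches_tensG_tensH` + ★ `coe_tens₀`)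
    (htens : ∀ (S : Finset (Places L)) (fS : TestS₀ L H ι T hT S) (fT : Unr₀ L H S),
      ∃ (T₁ : UnitaryGroup.PureTensor L 3 H) (T' : UnitaryGroup.PureTensor L 3 (splitForm L 3)),
        T₁.IsTest ∧ T'.IsTest ∧ T₁.eval = (toPureTensor S fS fT).eval ∧
        ⇑((ghOfFibres ι T hT (⟨traceGp, Smooth, HomogPacketG 𝔩 𝔞 μ infOf aTok, SpectralPacketH 𝔩 𝔞 𝔞H DiscH, nG, nH,
            (fun Q => Q.1.trOn S₀ (fun v => @Measure.map _ _ (borel _) _ (ψ v) (νG v)) archTrG), (fun ρ => ρ.trH νH archTrH), Matches⟩ : Sockets L H μGp) hg hsm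
            (fun S Q fS => Q.1.trSψ ψ S (fun v => @Measure.map _ _ (borel _) _ (ψ v) (νG v)) archTr fS) (fun S ρ fS => (σ : ℂ) * ρ.trHSψ ψ S (fun v => @Measure.map _ _ (borel _) _ (ψ v) (νG v)) archTr fS)).tensG S fS fT) = T'.eval ∧
        (∀ v, T'.loc v = T₁.loc v ∘ (ψ v).symm) ∧
        (letI : ∀ γ : UnitaryGroup.arch (↥(maximalRealSubfield L)) L (IsCMField.complexConj L) 3 H,
        MeasurableSpace (UnitaryGroup.arch (↥(maximalRealSubfield L)) L (IsCMField.complexConj L) 3 H ⧸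
          Subgroup.centralizer ({γ} : Set (UnitaryGroup.arch (↥(maximalRealSubfield L)) L (IsCMField.complexConj L) 3 H))) := fun _ => borel _
         letI : ∀ γ : UnitaryGroup.arch (↥(maximalRealSubfield L)) L (IsCMField.complexConj L) 3 (splitForm L 3),
        MeasurableSpace (UnitaryGroup.arch (↥(maximalRealSubfield L)) L (IsCMField.complexConj L) 3 (splitForm L 3) ⧸
          Subgroup.centralizer ({γ} : Set (UnitaryGroup.arch (↥(maximalRealSubfield L)) L (IsCMField.complexConj L) 3 (splitForm L 3)))) := fun _ => borel _
         IsArchInnerTransfer L H m' m T₁.arch T'.arch))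
    (htensH : ∀ (S : Finset (Places L)) (fS : TestS₀ L H ι T hT S) (fT : Unr₀ L H S),
      ∃ (T₁ : UnitaryGroup.PureTensor L 3 H) (TH : UnitaryGroup.PureTensor₂ L (splitForm L 2) (splitForm L 1)),
        T₁.IsTest ∧ TH.IsUnramified₂ ∧ (∀ v, IsLocSmooth (TH.loc v)) ∧ ArchSmooth₂ L TH.arch ∧ T₁.eval = (toPureTensor S fS fT).eval ∧
        ⇑((ghOfFibres ι T hT (⟨traceGp, Smooth, HomogPacketG 𝔩 𝔞 μ infOf aTok, SpectralPacketH 𝔩 𝔞 𝔞H DiscH, nG, nH,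
            (fun Q => Q.1.trOn S₀ (fun v => @Measure.map _ _ (borel _) _ (ψ v) (νG v)) archTrG), (fun ρ => ρ.trH νH archTrH), Matches⟩ : Sockets L H μGp) hg hsm
            (fun S Q fS => Q.1.trSψ ψ S (fun v => @Measure.map _ _ (borel _) _ (ψ v) (νG v)) archTr fS) (fun S ρ fS => (σ : ℂ) * ρ.trHSψ ψ S (fun v => @Measure.map _ _ (borel _) _ (ψ v) (νG v)) archTr fS)).tensH S fS fT) = TH.eval ∧
        (letI : ∀ (v : HeightOneSpectrum (𝓞 ↥(maximalRealSubfield L))) (a : (cmDatum L 2 (splitForm L 2)).Local v × (cmDatum L 1 (splitForm L 1)).Local v), MeasurableSpace (((cmDatum L 2 (splitForm L 2)).Local v × (cmDatum L 1 (splitForm L 1)).Local v) ⧸ Subgroup.centralizer ({a} : Set ((cmDatum L 2 (splitForm L 2)).Local v × (cmDatum L 1 (splitForm L 1)).Local v))) := fun _ _ => borel _;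
         letI : ∀ (v : HeightOneSpectrum (𝓞 ↥(maximalRealSubfield L))) (γ : (cmDatum L 3 H).Local v), MeasurableSpace ((cmDatum L 3 H).Local v ⧸ Subgroup.centralizer ({γ} : Set ((cmDatum L 3 H).Local v))) := fun _ _ => borel _;
         ∀ v, IsLocalDeltaTransfer L H v (Δ' v) (mH v) (mG' v) (TH.loc v) (T₁.loc v)) ∧
        (letI : ∀ a : UnitaryGroup.arch (↥(maximalRealSubfield L)) L (IsCMField.complexConj L) 2 (splitForm L 2) × UnitaryGroup.arch (↥(maximalRealSubfield L)) L (IsCMField.complexConj L) 1 (splitForm L 1), MeasurableSpace ((UnitaryGroup.arch (↥(maximalRealSubfield L)) L (IsCMField.complexConj L) 2 (splitForm L 2) × UnitaryGroup.arch (↥(maximalRealSubfield L)) L (IsCMField.complexConj L) 1 (splitForm L 1)) ⧸ Subgroup.centralizer ({a} : Set (UnitaryGroup.arch (↥(maximalRealSubfield L)) L (IsCMField.complexConj L) 2 (splitForm L 2) × UnitaryGroup.arch (↥(maximalRealSubfield L)) L (IsCMField.complexConj L) 1 (splitForm L 1)))) := fun _ => borel _;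
         letI : ∀ γ : UnitaryGroup.arch (↥(maximalRealSubfield L)) L (IsCMField.complexConj L) 3 H,
        MeasurableSpace (UnitaryGroup.arch (↥(maximalRealSubfield L)) L (IsCMField.complexConj L) 3 H ⧸
          Subgroup.centralizer ({γ} : Set (UnitaryGroup.arch (↥(maximalRealSubfield L)) L (IsCMField.complexConj L) 3 H))) := fun _ => borel _;
         IsArchDeltaTransfer L H Tinf mHi m' TH.arch T₁.arch)) :
    letI : MeasurableSpace (Gp L H).Adelic := borel _
    haveI : BorelSpace (Gp L H).Adelic := ⟨rfl⟩
    haveI : IsFiniteMeasureOnCompacts νA := hνA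
    F0P3InnerFormClassificationV8.ClassificationKit.FactorisationPk
      (kitOfRecord L H ι T hT μGp
        (⟨traceGp, Smooth, HomogPacketG 𝔩 𝔞 μ infOf aTok, SpectralPacketH 𝔩 𝔞 𝔞H DiscH, nG, nH,
          (fun Q => Q.1.trOn S₀ (fun v => @Measure.map _ _ (borel _) _ (ψ v) (νG v)) archTrG), (fun ρ => ρ.trH νH archTrH), Matches⟩ : Sockets L H μGp)
        (ghOfFibres ι T hT (⟨traceGp, Smooth, HomogPacketG 𝔩 𝔞 μ infOf aTok, SpectralPacketH 𝔩 𝔞 𝔞H DiscH, nG, nH,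
            (fun Q => Q.1.trOn S₀ (fun v => @Measure.map _ _ (borel _) _ (ψ v) (νG v)) archTrG), (fun ρ => ρ.trH νH archTrH), Matches⟩ : Sockets L H μGp) hg hsm
          (fun S Q fS => Q.1.trSψ ψ S (fun v => @Measure.map _ _ (borel _) _ (ψ v) (νG v)) archTr fS) (fun S ρ fS => (σ : ℂ) * ρ.trHSψ ψ S (fun v => @Measure.map _ _ (borel _) _ (ψ v) (νG v)) archTr fS))
        ξd μω c jInf dsInf archTr νA νG ramCls₀) S₀ := by
  letI : MeasurableSpace (Gp L H).Adelic := borel _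
  haveI : BorelSpace (Gp L H).Adelic := ⟨rfl⟩
  haveI : IsFiniteMeasureOnCompacts νA := hνA
  letI : ∀ v : HeightOneSpectrum (𝓞 ↥(maximalRealSubfield L)), MeasurableSpace ((cmDatum L 3 H).Local v) := fun _ => borel _
  haveI : ∀ v : HeightOneSpectrum (𝓞 ↥(maximalRealSubfield L)), BorelSpace ((cmDatum L 3 H).Local v) := fun _ => ⟨rfl⟩
  haveI : ∀ v : HeightOneSpectrum (𝓞 ↥(maximalRealSubfield L)), (νG v).IsMulLeftInvariant := hνl
  haveI : ∀ v : HeightOneSpectrum (𝓞 ↥(maximalRealSubfield L)), IsFiniteMeasureOnCompacts (νG v) := hνc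
  have hμK : ∀ v : HeightOneSpectrum (𝓞 ↥(maximalRealSubfield L)), (νG v).real (cmLocalIntegralLevel L 3 H v : Set ((cmDatum L 3 H).Local v)) ≠ 0 :=
    fun v => by rw [hvol v]; exact one_ne_zero
  -- (TF-1)∕S₀ for every global packet of the kit at the transported measures (★ 3y′), and (TF-ind)∕S₀ for every discrete packet (★ 3y §4)
  haveI : ∀ v : HeightOneSpectrum (𝓞 ↥(maximalRealSubfield L)), (@Measure.map _ _ (borel _) _ (ψ v) (νG v)).IsMulLeftInvariant := fun v =>
    isMulLeftInvariant_map (ψ v : (cmDatum L 3 H).Local v →ₙ* (cmDatum L 3 (splitForm L 3)).Local v) (ψ v).continuous.measurable (ψ v).surjective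
  haveI : ∀ v : HeightOneSpectrum (𝓞 ↥(maximalRealSubfield L)), IsFiniteMeasureOnCompacts (@Measure.map _ _ (borel _) _ (ψ v) (νG v)) := fun v =>
    Measure.IsFiniteMeasureOnCompacts.map (νG v) (ψ v).toHomeomorph
  have h1 : ∀ Pg : GlobalPacket 𝔩, Pg.UnramTraceOneOff S₀ (fun v => @Measure.map _ _ (borel _) _ (ψ v) (νG v)) := fun Pg =>
    Pg.unramTraceOneOff_map_of_map_eq ψ νG h4 (fun v => hadm v _) S₀ hgood hψK fun v _ => hvol v
  have hind : ∀ Q : SpectralPacketG 𝔩 𝔞 μ, Q.PresentationIndepOn S₀ (fun v => @Measure.map _ _ (borel _) _ (ψ v) (νG v)) archTrG := fun Q =>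
    Q.presentationIndepOn_of_admissible S₀ (h1 Q.fin) (fun v => hadm v _) harchG
  -- `hat₀ S (germ t) fT = ∏_{v ∈ supp f^S} t_v(f^S_v)` and `vol(K′_v) = 1`
  have hhat : ∀ (S : Finset (Places L)) (t : EvpData L H) (fT : Unr₀ L H S),
      hat₀ L H S (germ L H S t) fT = ∏ v ∈ fT.T, (((νG v).real (cmLocalIntegralLevel L 3 H v : Set ((cmDatum L 3 H).Local v)) : ℂ) * t v (fT.loc v)) := by
    intro S t fT
    -- `germ` here is ★ V6's spelling of ★ V5's `germ` (definitionally the same quotient map), so ★ `hat₀_germ` is used through `rfl`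
    have h0 : hat₀ L H S (germ L H S t) fT = UnrTensor.hatOf t fT := rfl
    rw [h0, F0P3UnrTensorInstance.UnrTensor.hatOf_def]
    exact Finset.prod_congr rfl fun v _ => by rw [hvol v, Complex.ofReal_one, one_mul]
  refine ⟨fun S Q fS fT hS₀ => ⟨fun hram => ?_, fun hram => ?_⟩, fun S ρ fS fT hS₀ => ⟨fun hram => ?_, fun hram => ?_⟩⟩
  · -- (P1)-G, unramified branch: 3u″ (u5′) at the pin's `(T₁, T′)`
    obtain ⟨T₁, T', hT₁, hT', hTe, hF, hloc, harch⟩ := htens S fS fT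
    have hramG : Q.1.fin.ramFinset ⊆ S := by rw [← hξrG]; exact hram
    have key := Q.1.trOn_partner_eq_trSψ_mul_prod_of_eval_eq ψ S₀ (h1 Q.1.fin) (hind Q.1) h4 (fun v => hadm v _) hgood hψK hμK S hS₀ hramG fS fT
      hT₁ hTe hT' hloc hF archTr harch' m' m hlaw harch
    refine key.trans ?_
    change _ = Q.1.trSψ ψ S (fun v => @Measure.map _ _ (borel _) _ (ψ v) (νG v)) archTr fS * hat₀ L H S (germ L H S (ξd.evpG Q)) fT
    rw [hξG, hhat]
  · -- (P1)-G, ramified branch: 3u‴ (z1′)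
    obtain ⟨T₁, T', hT₁, hT', hTe, hF, hloc, harch⟩ := htens S fS fT
    have hramG : ¬ Q.1.fin.ramFinset ⊆ S := by rw [← hξrG]; exact hram
    exact Q.1.trOn_partner_eq_zero_of_not_ramFinset_subset_of_eval_eq ψ S₀ (h1 Q.1.fin) (hind Q.1) hU (fun v => hadm v _) hgood hψK S hS₀ hramG fS fT
      hT₁ hTe hT' hloc hF archTr harch' m' m hlaw harch
  · -- (P1)-H, unramified branch: 3u″ (uH5′) at the pin's `(T₁, T^H)`
    obtain ⟨T₁, TH, hT₁, hTH, hsH, haH, hTe, hFH, hΔ, harchΔ⟩ := htensH S fS fT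
    have hramH : ρ.ramFinsetH ⊆ S := by rw [← hξrH]; exact hram
    have key := ρ.trH_partner_eq_trHSψ_mul_prod_of_eval_eq_off_signed s Sbad hs ψ (h1H ρ) (fun v => hadmH v _) harchH S₀ (h1 ρ.imageG) h4 (fun v => hadm v _) hgood hψK hμK S hS₀ hramH
      fS fT hTH hsH haH hFH hT₁ hTe archTr harch' (hlawψ ρ) hΔ hlawInf harchΔ
    refine key.trans ?_
    change _ = (σ : ℂ) * ρ.trHSψ ψ S (fun v => @Measure.map _ _ (borel _) _ (ψ v) (νG v)) archTr fS * hat₀ L H S (germ L H S (ξd.evpH ρ)) fT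
    rw [hξH, hhat, hσ]
    exact (mul_assoc _ _ _).symm
  · -- (P1)-H, ramified branch: ★ 3u′ (z2) (no `G`-side law involved)
    obtain ⟨T₁, TH, hT₁, hTH, hsH, haH, hTe, hFH, hΔ, harchΔ⟩ := htensH S fS fT
    have hramH : ¬ ρ.ramFinsetH ⊆ S := by rw [← hξrH]; exact hram
    exact ρ.trH_partner_eq_zero_of_not_ramFinsetH_subset_of_eval_eq_signed s ψ (h1H ρ) (fun v => hadmH v _) harchH hU (fun v => hadm v _) S₀ hgood hψK S hS₀ hramH
      fS fT hTH hsH haH hFH hT₁ hTe archTr harch' (hlawψ ρ) hΔ hlawInf harchΔ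

end Summit.HodgeConjecture.HodgeConjecture.Cruxes.H413.F0P3SpectralPacket.SpectralPacketG

/-! ## §2 The (P3′)-H clause under a constant re-scaling of the `H`-trace slot [§14.6 p. 243 l. 9 – p. 244 l. 17] -/

namespace Summit.HodgeConjecture.HodgeConjecture.Cruxes.H413.F0P3bLocalExpansionAtKitOfRecord

open Summit.HodgeConjecture.HodgeConjecture.Cruxes.H413.F0P3GHSideOfFibres (ghOfFibres)

variable {L : Type} [Field L] [NumberField L] [IsCMField L] {H : Matrix (Fin 3) (Fin 3) L} (ι : L →+* ℂ) (T : GL (Fin 3) ℂ)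
  (hT : (T : Matrix (Fin 3) (Fin 3) ℂ)ᴴ * H.map ι * (T : Matrix (Fin 3) (Fin 3) ℂ) = Literature.Geometry.ComplexHyperbolic.BallModel.J)
  {μ : Measure (Gp L H).automorphicQuotient} [(Gp L H).IsAutomorphicMeasure μ]
  (𝔰 : Sockets L H μ) (hg : ∀ f' : TestGp L H, 𝔰.Smooth f' → ∃ (f : TestG L) (fH : TestH L), 𝔰.Matches f' f fH)
  (hsm : ∀ (S : Finset (Places L)) (fS : TestS₀ L H ι T hT S) (fT : Unr₀ L H S), 𝔰.Smooth (tens₀ S fS fT))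
  (trGS : ∀ S : Finset (Places L), 𝔰.PacketG → TestS₀ L H ι T hT S → ℂ) (trHS : ∀ S : Finset (Places L), 𝔰.PacketH → TestS₀ L H ι T hT S → ℂ)
  (ξd : XiSide L H 𝔰.PacketG 𝔰.PacketH) (μω : HeckeCharacter L) (c σ : ℚ) (jInf dsInf : ℤ → ℤ → ℤ → Cinf)
  (archTr : Cinf → (UnitaryGroup.arch (↥(maximalRealSubfield L)) L (IsCMField.complexConj L) 3 H → ℂ) → ℂ)
  (μv : ∀ v : Places L, @Measure ((cmDatum L 3 H).Local v) (borel _))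

/-- **The (P3′)-H clause at `σ·c` for the σ-scaled `H`-trace slot**: if ★ `HTraceProductForm … c …` holds for the `ghOfFibres` side with `H`-slot `trHS`, it holds with outer sign `σ·c` for the
side with slot `fun S ρ f′_S => σ · trHS S ρ f′_S` (★ `ghOfFibres`'s `TestSH`, `MatchesS` do not read the slot).  The junction's `hPH` after re-basing K9's outer sign `c′ := σ(H)·c` (q5:
`c` is only ∃-consumed downstream). [cite: Rogawski1990, §14.6 pp. 242–244, p. 243 l. 9 – p. 244 l. 17] -/
theorem hTraceProductForm_ghOfFibres_const_mul
    (h : HTraceProductForm ι T hT (ghOfFibres ι T hT 𝔰 hg hsm trGS trHS) ξd μω c jInf dsInf archTr μv) :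
    HTraceProductForm ι T hT (ghOfFibres ι T hT 𝔰 hg hsm trGS (fun S ρ fS => (σ : ℂ) * trHS S ρ fS)) ξd μω (σ * c) jInf dsInf archTr μv := by
  intro ξ S hS fS fSG fSH hm
  have e := h ξ S hS fS fSG fSH hm
  change (σ : ℂ) * trHS S (ξd.ρXi ξ) fSH = _
  change trHS S (ξd.ρXi ξ) fSH = _ at e
  rw [e, Rat.cast_mul]
  ring

end Summit.HodgeConjecture.HodgeConjecture.Cruxes.H413.F0P3bLocalExpansionAtKitOfRecord

end
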